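import Summits.HodgeConjecture.HodgeConjecture.Theses.EndoscopicMiddleDegree

/-!
# `HigherBlasiusRogawskiClass` (stmt-HodgeConjecture-13662) · Negative · dictionary and consequences

Negative-side knowledge for the crux `EndoscopicMiddleDegree.HigherBlasiusRogawskiClass`
(route `EndoscopicMiddleDegree`, rank 5, an `∃`-statement):

  `∃ X (D : UnitaryBallQuotientDatum 5 X) (c ∈ H⁴(X(ℂ); ℂ)), IsRationalClass c ∧ IsOfHodgeType 5 X 4 2 2 c ∧
     c ∉ SC²(D) ⊔ span_ℂ {d₁ ∪ d₂ : dᵢ ∈ N¹ H²}`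

(some compact arithmetic 5-ball quotient carries a rational Hodge `(2,2)`-class outside the span —
written `Span(D)` below — of the codimension-2 special cycles and of the products of divisor classes).
All theorems here are unconditional and sorry-free; hypotheses that are open statements are explicit
binders (never `def … : Prop` facts), and `Span(D)` is always written out literally (no new `def`, so
that the file is a pure-proof helper file). Extracted from the standing disprover's work file
`Cruxes/HigherBlasiusRogawskiClass/Disproof.lean` (refuter-cdisprove-stmt-HodgeConjecture-13662-0,
cycle 1, 2026-08-16) so that ideators, planners and provers can import them.

* `higherBlasiusRogawskiClass_iff_not_spanningAtFive`: the crux is LITERALLY the negation of the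
  `∀`-statement "spanning at five" (at `p = 5` every rational `(2,2)`-class lies in `Span(D)`) —
  disproving the crux = proving a BMM-type spanning theorem in the first diagonal type outside the
  range `6a < 2p + 2` of BMM Thm. 4.
* `not_higherBlasiusRogawskiClass_finrank_le_variant`: the natural variant excluding the classes
  supported on special subvarieties of `E`-dimension `≤ 2` (instead of `= 2`) is FALSE on the nose:
  `W = 0` is (vacuously) totally positive, its special subvariety contains every complex point
  (`UnitaryBallQuotientDatum.pt_mem_specialSubvariety_bot`), so every degree-4 class is supported on
  it (`classesSupportedOn_specialSubvariety_bot`). The side condition `finrank W = 2` is load-bearing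
  in exactly this sense; any re-typing with `≤` must keep `1 ≤ finrank W`.
* `span_le_algebraicClasses`: granted the route's support item `CupProductAlgebraic`, `Span(D)`
  consists of algebraic classes (special subvarieties are Zariski closed of codimension `≥ 2`: fields
  `isClosed_specialSubvariety`, `le_coheight_of_mem_specialSubvariety` of the datum); hence
  `mem_algebraicClasses_of_not_higherBlasiusRogawskiClass`: the NEGATION of the crux is (with
  `CupProductAlgebraic`) the cycle part of the Hodge conjecture in degree 4 for every `X` carrying a
  `UnitaryBallQuotientDatum 5 X` — the route's kill criterion (iv) ("¬crux is good news") made formal.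
* `exists_not_hodgeConjectureFor_of_higherBlasiusRogawskiClass`, `not_hodgeConjecture_of_…`,
  `higherBlasiusRogawskiClass_false_of_hodge_of_algebraicInSpan`, `spanningAtFive_iff_hodge_degree_four`:
  granted the cycle-theoretic hypothesis `hA` (every codimension-2 ALGEBRAIC class of a compact
  arithmetic 5-ball quotient lies in `Span(D)` — expected from the endoscopic classification, see the
  paper analysis in `Disproof.lean` §4: algebraic classes are Tate classes, and the only
  `(2,2)`-classes outside the span sit in Hecke-isotypic pieces whose `(2,2)`-line is glued to a
  `(0,4)`/`(4,0)`-line by the multiplicity formula and carries an IRREDUCIBLE 2- or 3-dimensional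
  Galois representation), the crux is a COUNTEREXAMPLE TO THE HODGE CONJECTURE on a smooth
  projective 5-fold. So the crux is not an "L2 side bet demanding a non-geodesic cycle": modulo
  `hA` it is `¬ HodgeConjecture`, and it is refuted by the summit restricted to 5-ball quotients.

References: [BergeronMillsonMoeglin2016Balls] = arXiv:1306.1515 (Thm. 4, Props. 80–82, Thm. 72);
Marshall–Shin arXiv:1804.05047 §4 (KMSW Thm. 1.7.1 for unitary groups compact at all but one real
place); Arancibia–Moeglin–Renard arXiv:1507.01432 (Arthur packets = Adams–Johnson packets);
Blasius–Rogawski zbl:0828.14012 (the `p = 2` phenomenon).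

Maintenance note (full-build repair 2026-08-16): the crux `HigherBlasiusRogawskiClass`
(stmt-HodgeConjecture-13662) was DROPPED from route `EndoscopicMiddleDegree` at rev 4 (2026-08-16,
item closed `moot`), so the gate-written Theses file no longer declares
`Theses.EndoscopicMiddleDegree.HigherBlasiusRogawskiClass` and the five theorems below naming it
stopped elaborating. Its typed statement (the item's ledger signature, formerly the body of the Theses
`def`) is kept here VERBATIM as the `@[conjecture] def HigherBlasiusRogawskiClass : Prop` of §0 — an
open `∃`-claim, never asserted (only a hypothesis, or one side of an `↔`/under `¬`) — so that every
theorem keeps its exact statement and proof (Theorems files are append-only). This is the one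
exception to "no new `def`" above; nothing else changed.
-/

noncomputable section

namespace Summit.HodgeConjecture.HodgeConjecture.Theorems.HigherBlasiusRogawskiClass.Negative

open Summit.HodgeConjecture.HodgeConjecture.Theses.EndoscopicMiddleDegree
open Literature.AlgebraicGeometry.ShimuraVarieties Literature.AlgebraicGeometry.HodgeTheory
  Literature.AlgebraicGeometry.Motives Literature.AlgebraicTopology.SingularHomology

/-! ## §0 The subject: the dropped crux, recorded verbatim -/

/-- OPEN — **a higher Blasius–Rogawski class** (card B3, the "L2 bet", first instance `p = 5`,
degree `4`, `a = 2`): some compact arithmetic 5-ball quotient `X` (a `UnitaryBallQuotientDatum 5 X`)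
carries a RATIONAL class of Hodge type `(2,2)` in `H⁴(X(ℂ); ℂ)` lying OUTSIDE
`Span(D) = SC²(D) ⊔ span_ℂ{d₁ ∪ d₂ : dᵢ ∈ N¹H²}` (the special cycle classes `specialCycleClasses D 2`
written out as their definitional unfolding, `⨆ W (_ : IsTotallyPositive …) (_ : finrank W = 2),
classesSupportedOn X (D.specialSubvariety W) 4`, and the products of two divisor classes) — i.e.
outside everything theta lifts and Lefschetz produce there; `(2,2)` at `p = 5` is the first diagonal
type outside the range `6a < 2p + 2` of BMM Thm. 4. Literally the registered signature of the crux
`HigherBlasiusRogawskiClass` (stmt-HodgeConjecture-13662; formerly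
`Theses.EndoscopicMiddleDegree.HigherBlasiusRogawskiClass`, DROPPED from the route at rev 4 and closed
`moot` 2026-08-16 — kept here under its name as an `@[conjecture] def`, CONVENTIONS §4 / D-0014: an
unproved statement is a `Prop`, never a theorem, so that the negative-knowledge lemmas of this file
keep their subject; use only as a hypothesis or inside `↔`/`¬`). POSED in this project (route
route-HodgeConjecture-EndoscopicMiddleDegree, 2026-08-15; no printed statement — BMM Thm. 4 is the
spanning theorem in the complementary range). [folklore] -/
@[conjecture] def HigherBlasiusRogawskiClass : Prop :=
  ∃ (X : Literature.AlgebraicGeometry.Motives.SchemeOver ℂ)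
    (D : Literature.AlgebraicGeometry.ShimuraVarieties.UnitaryBallQuotientDatum 5 X)
    (c : Literature.AlgebraicGeometry.HodgeTheory.complexBetti X (2 * 2)),
    Literature.AlgebraicGeometry.HodgeTheory.IsRationalClass c ∧
      Literature.AlgebraicGeometry.HodgeTheory.IsOfHodgeType 5 X (2 * 2) 2 2 c ∧
        c ∉ (⨆ (W : Submodule D.E (Fin (5 + 1) → D.E))
            (_ : Literature.AlgebraicGeometry.ShimuraVarieties.IsTotallyPositive
              (Literature.AlgebraicGeometry.ShimuraVarieties.conjRingHom D.E) D.H W)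
            (_ : Module.finrank D.E W = 2),
            Literature.AlgebraicGeometry.HodgeTheory.classesSupportedOn X (D.specialSubvariety W)
              (2 * 2)) ⊔
          Submodule.span ℂ {z : Literature.AlgebraicGeometry.HodgeTheory.complexBetti X (2 * 2) |
            ∃ d₁ ∈ Literature.AlgebraicGeometry.HodgeTheory.algebraicClasses X 1,
              ∃ d₂ ∈ Literature.AlgebraicGeometry.HodgeTheory.algebraicClasses X 1,
                z = Literature.AlgebraicTopology.SingularHomology.cupProduct
                  (show 2 * 1 + 2 * 1 = 2 * 2 by norm_num) d₁ d₂}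

variable {X : SchemeOver ℂ}

/-! ## §1 Dictionary -/

/-- **The crux is literally the negation of "spanning at `p = 5`"** — on every `X` carrying a
`UnitaryBallQuotientDatum 5 X`, every rational class of Hodge type `(2,2)` in `H⁴(X(ℂ); ℂ)` lies in
`Span(D) = SC²(D) ⊔ span_ℂ{d₁ ∪ d₂}` (the shape of BMM Thm. 4, diagonal case, for rational classes, in
the first type `(a,a) = (2,2)`, `p = 5`, where `6a < 2p + 2` fails with equality; open). So to
DISPROVE `HigherBlasiusRogawskiClass` is to PROVE that spanning theorem, and conversely.
[cite: BergeronMillsonMoeglin2016Balls, Thm. 4] -/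
theorem higherBlasiusRogawskiClass_iff_not_spanningAtFive :
    HigherBlasiusRogawskiClass ↔
      ¬ ∀ (X : SchemeOver ℂ) (D : UnitaryBallQuotientDatum 5 X) (c : complexBetti X (2 * 2)),
          IsRationalClass c → IsOfHodgeType 5 X (2 * 2) 2 2 c → c ∈
          (⨆ (W : Submodule D.E (Fin (5 + 1) → D.E))
            (_ : IsTotallyPositive (conjRingHom D.E) D.H W) (_ : Module.finrank D.E W = 2),
            classesSupportedOn X (D.specialSubvariety W) (2 * 2)) ⊔
          Submodule.span ℂ {z : complexBetti X (2 * 2) | ∃ d₁ ∈ algebraicClasses X 1,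
            ∃ d₂ ∈ algebraicClasses X 1,
              z = cupProduct (show 2 * 1 + 2 * 1 = 2 * 2 by norm_num) d₁ d₂} := by
  constructor
  · rintro ⟨X, D, c, hr, hh, hc⟩ hS
    exact hc (hS X D c hr hh)
  · intro h
    by_contra h'
    exact h fun X D c hr hh ↦ by_contra fun hc ↦ h' ⟨X, D, c, hr, hh, hc⟩

/-! ## §2 The side condition `finrank W = 2` is load-bearing: the `≤ 2` variant is false -/

/-- Every degree-`i` class is supported on the special subvariety of `W = 0` (whose complex points
are all of `X(ℂ)`: `UnitaryBallQuotientDatum.pt_mem_specialSubvariety_bot`), so that subvariety's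
`classesSupportedOn` is `⊤`. [cite: BergeronMillsonMoeglin2016Balls, Part 2 §3.3] -/
theorem classesSupportedOn_specialSubvariety_bot {p : ℕ} (D : UnitaryBallQuotientDatum p X)
    (i : ℕ) : classesSupportedOn X (D.specialSubvariety ⊥) i = ⊤ := by
  refine eq_top_iff.2 fun x _ ↦ ?_
  rw [mem_classesSupportedOn_iff]
  haveI : IsEmpty (complexPointsCompl X (D.specialSubvariety ⊥)) :=
    ⟨fun P ↦ P.2 (D.pt_mem_specialSubvariety_bot P.1)⟩
  haveI := ModuleCat.subsingleton_of_isZero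
    (isZero_singularCohomology_of_isEmpty ℂ ℂ (E := complexPointsCompl X (D.specialSubvariety ⊥)) i)
  exact Subsingleton.elim _ _

/-- **The `finrank ≤ 2` variant of the crux is false.** Replacing `Module.finrank D.E W = 2` by
`Module.finrank D.E W ≤ 2` in the excluded supremum lets in `W = ⊥` (vacuously totally positive, of
`E`-dimension `0`), whose special subvariety carries EVERY class
(`classesSupportedOn_specialSubvariety_bot`); the excluded span is then `⊤` and no class lies outside
it. Moral for re-typings "with supports of dimension `≤ 2`": keep `1 ≤ finrank W`.
[folklore] -/
theorem not_higherBlasiusRogawskiClass_finrank_le_variant :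
    ¬ ∃ (X : SchemeOver ℂ) (D : UnitaryBallQuotientDatum 5 X) (c : complexBetti X (2 * 2)),
      IsRationalClass c ∧ IsOfHodgeType 5 X (2 * 2) 2 2 c ∧
        c ∉ (⨆ (W : Submodule D.E (Fin (5 + 1) → D.E))
            (_ : IsTotallyPositive (conjRingHom D.E) D.H W) (_ : Module.finrank D.E W ≤ 2),
            classesSupportedOn X (D.specialSubvariety W) (2 * 2)) ⊔
          Submodule.span ℂ {z : complexBetti X (2 * 2) | ∃ d₁ ∈ algebraicClasses X 1,
            ∃ d₂ ∈ algebraicClasses X 1,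
              z = cupProduct (show 2 * 1 + 2 * 1 = 2 * 2 by norm_num) d₁ d₂} := by
  rintro ⟨X, D, c, -, -, hc⟩
  refine hc (Submodule.mem_sup_left ?_)
  have h0 : IsTotallyPositive (conjRingHom D.E) D.H ⊥ := fun w hw hne ↦
    (hne ((Submodule.mem_bot _).1 hw)).elim
  have hle : Module.finrank D.E (⊥ : Submodule D.E (Fin (5 + 1) → D.E)) ≤ 2 := by
    rw [finrank_bot]; exact Nat.zero_le _
  refine Submodule.mem_iSup_of_mem ⊥
    (Submodule.mem_iSup_of_mem h0 (Submodule.mem_iSup_of_mem hle ?_))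
  rw [classesSupportedOn_specialSubvariety_bot]
  exact Submodule.mem_top

/-! ## §3 The excluded span is algebraic; `¬ crux` is the Hodge conjecture in degree 4 on the sector -/

/-- **The excluded span consists of algebraic classes**, granted the route's support item
`CupProductAlgebraic` (products of algebraic classes are algebraic; Voisin II Prop. 9.20): the special
subvarieties `c(W)`, `dim_E W = 2`, are Zariski closed of codimension `≥ 2` at each point (fields
`isClosed_specialSubvariety`, `le_coheight_of_mem_specialSubvariety`), so the classes supported on them
lie in `N² H⁴ = algebraicClasses X 2` (`classesSupportedOn_le_supportedClasses`), and products of two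
divisor classes lie there by `CupProductAlgebraic` at `l = k = 1` (`X` is smooth projective of
dimension 5 by `D.isSmoothProjective`). [cite: BergeronMillsonMoeglin2016Balls, Part 2 §3.2] [cite: VoisinHodgeII2003, Prop. 9.20] -/
theorem span_le_algebraicClasses (hcup : CupProductAlgebraic) (D : UnitaryBallQuotientDatum 5 X) :
    (⨆ (W : Submodule D.E (Fin (5 + 1) → D.E))
            (_ : IsTotallyPositive (conjRingHom D.E) D.H W) (_ : Module.finrank D.E W = 2),
            classesSupportedOn X (D.specialSubvariety W) (2 * 2)) ⊔
          Submodule.span ℂ {z : complexBetti X (2 * 2) | ∃ d₁ ∈ algebraicClasses X 1,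
            ∃ d₂ ∈ algebraicClasses X 1,
              z = cupProduct (show 2 * 1 + 2 * 1 = 2 * 2 by norm_num) d₁ d₂} ≤ algebraicClasses X 2 := by
  refine sup_le ?_ ?_
  · refine iSup_le fun W ↦ iSup_le fun hW ↦ iSup_le fun hk ↦ ?_
    refine classesSupportedOn_le_supportedClasses (D.isClosed_specialSubvariety W hW)
      (fun z hz ↦ ?_) _
    have h := D.le_coheight_of_mem_specialSubvariety W hW z hz
    rw [hk] at h
    exact_mod_cast h
  · refine Submodule.span_le.2 ?_
    rintro z ⟨d₁, hd₁, d₂, hd₂, rfl⟩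
    exact hcup D.isSmoothProjective 1 1 d₁ d₂ hd₁ hd₂

/-- **Kill criterion (iv) of the route, formal**: the NEGATION of the crux together with
`CupProductAlgebraic` gives the cycle part of the Hodge conjecture in degree 4 (codimension 2) for
EVERY `X` carrying a `UnitaryBallQuotientDatum 5 X` — HC in the middle third (`n = 2 ∈ ]5/3, 10/3[`,
excluded by BMM Cor. 2) of compact arithmetic 5-ball quotients. [cite: BergeronMillsonMoeglin2016Balls, Cor. 2] -/
theorem mem_algebraicClasses_of_not_higherBlasiusRogawskiClass (h : ¬ HigherBlasiusRogawskiClass)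
    (hcup : CupProductAlgebraic) (D : UnitaryBallQuotientDatum 5 X) (c : complexBetti X (2 * 2))
    (hr : IsRationalClass c) (hh : IsOfHodgeType 5 X (2 * 2) 2 2 c) : c ∈ algebraicClasses X 2 := by
  by_contra hc
  exact h ⟨X, D, c, hr, hh, fun hmem ↦ hc (span_le_algebraicClasses hcup D hmem)⟩

/-! ## §4 Modulo "algebraic classes lie in the span", the crux is `¬ HodgeConjecture`

**The hypothesis `hA` ("algebraic classes in the span at `p = 5`")** used below: on every `X`
carrying a `UnitaryBallQuotientDatum 5 X`, every codimension-2 ALGEBRAIC class lies in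
`Span(D)` — a statement about algebraic cycles on compact arithmetic 5-ball quotients, free of
the Hodge conjecture, written as an explicit binder (it is open and NOT a tree fact). It is expected
from the endoscopic classification (disprover's paper analysis,
`Cruxes/HigherBlasiusRogawskiClass/Disproof.lean` §4): cycle classes are Tate classes; the
Hecke-isotypic pieces of `H⁴` outside the theta/Lefschetz part (GL₂- and GL₃-CAP Arthur parameters
`μ ⊠ R₂ ⊞ ρ`) carry an IRREDUCIBLE 2- or 3-dimensional Galois representation `r_μ` gluing their
`(2,2)`-line to a `(0,4)`- or `(4,0)`-line (the Adams–Johnson packet characters of the two members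
agree on the global component group), so they contain no Tate line; and the theta/Lefschetz
`(2,2)`-classes lie in `span{SDiv ∪ H^{1,1}} + L·H^{1,1} ⊆ Div·Div` by BMM's range-free steps (Thm. 72
with `a = 2`, Thms. 69–71) and Cor. 62 (`H^{1,1}` is defined over `ℚ` for `p ≥ 3`). -/

/-- **Modulo `hA` (algebraic classes in the span), a witness of the crux is a counterexample to the
Hodge conjecture on a smooth projective 5-fold**: the witnessing class is rational of type `(2,2)` and
not in the span, hence not algebraic. [folklore] -/
theorem exists_not_hodgeConjectureFor_of_higherBlasiusRogawskiClass (h : HigherBlasiusRogawskiClass)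
    (hA : ∀ (X : SchemeOver ℂ) (D : UnitaryBallQuotientDatum 5 X),
      algebraicClasses X 2 ≤
        (⨆ (W : Submodule D.E (Fin (5 + 1) → D.E))
            (_ : IsTotallyPositive (conjRingHom D.E) D.H W) (_ : Module.finrank D.E W = 2),
            classesSupportedOn X (D.specialSubvariety W) (2 * 2)) ⊔
          Submodule.span ℂ {z : complexBetti X (2 * 2) | ∃ d₁ ∈ algebraicClasses X 1,
            ∃ d₂ ∈ algebraicClasses X 1,
              z = cupProduct (show 2 * 1 + 2 * 1 = 2 * 2 by norm_num) d₁ d₂}) :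
    ∃ X : SchemeOver ℂ, Nonempty (UnitaryBallQuotientDatum 5 X) ∧ IsSmoothProjective 5 X ∧
      ¬ HodgeConjectureFor 5 X := by
  obtain ⟨X, D, c, hr, hh, hc⟩ := h
  exact ⟨X, ⟨D⟩, D.isSmoothProjective, fun hHC ↦ hc (hA X D (hHC.2 2 c hr hh))⟩

/-- **Modulo `hA` (algebraic classes in the span), the crux refutes the summit.** [folklore] -/
theorem not_hodgeConjecture_of_higherBlasiusRogawskiClass (h : HigherBlasiusRogawskiClass)
    (hA : ∀ (X : SchemeOver ℂ) (D : UnitaryBallQuotientDatum 5 X),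
      algebraicClasses X 2 ≤
        (⨆ (W : Submodule D.E (Fin (5 + 1) → D.E))
            (_ : IsTotallyPositive (conjRingHom D.E) D.H W) (_ : Module.finrank D.E W = 2),
            classesSupportedOn X (D.specialSubvariety W) (2 * 2)) ⊔
          Submodule.span ℂ {z : complexBetti X (2 * 2) | ∃ d₁ ∈ algebraicClasses X 1,
            ∃ d₂ ∈ algebraicClasses X 1,
              z = cupProduct (show 2 * 1 + 2 * 1 = 2 * 2 by norm_num) d₁ d₂}) : ¬ _root_.HodgeConjecture := by
  obtain ⟨X, -, hX, hHC⟩ := exists_not_hodgeConjectureFor_of_higherBlasiusRogawskiClass h hA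
  exact fun hc ↦ hHC (hc hX)

/-- **`¬ HigherBlasiusRogawskiClass` modulo (HC on the sector at `p = 5`) ∧ `hA`**: if the Hodge
conjecture holds for every `X` carrying a `UnitaryBallQuotientDatum 5 X` (the `p = 5` analogue of the
route's own target) and algebraic classes lie in the span, the crux is false. [folklore] -/
theorem higherBlasiusRogawskiClass_false_of_hodge_of_algebraicInSpan
    (hHC : ∀ X : SchemeOver ℂ, Nonempty (UnitaryBallQuotientDatum 5 X) → HodgeConjectureFor 5 X)
    (hA : ∀ (X : SchemeOver ℂ) (D : UnitaryBallQuotientDatum 5 X),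
      algebraicClasses X 2 ≤
        (⨆ (W : Submodule D.E (Fin (5 + 1) → D.E))
            (_ : IsTotallyPositive (conjRingHom D.E) D.H W) (_ : Module.finrank D.E W = 2),
            classesSupportedOn X (D.specialSubvariety W) (2 * 2)) ⊔
          Submodule.span ℂ {z : complexBetti X (2 * 2) | ∃ d₁ ∈ algebraicClasses X 1,
            ∃ d₂ ∈ algebraicClasses X 1,
              z = cupProduct (show 2 * 1 + 2 * 1 = 2 * 2 by norm_num) d₁ d₂}) : ¬ HigherBlasiusRogawskiClass := fun h ↦ by
  obtain ⟨X, hD, -, hX⟩ := exists_not_hodgeConjectureFor_of_higherBlasiusRogawskiClass h hA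
  exact hX (hHC X hD)

/-- **Modulo the two cycle-theoretic statements `CupProductAlgebraic` (known in print) and `hA`
(expected), "spanning at `p = 5`" (i.e. `¬ crux`) ↔ "rational `(2,2)`-classes on compact arithmetic
5-ball quotients are algebraic"** — so, granted `hA`, the crux is EQUIVALENT to the failure of the
degree-4 Hodge conjecture on some compact arithmetic 5-ball quotient. [folklore] -/
theorem spanningAtFive_iff_hodge_degree_four (hcup : CupProductAlgebraic)
    (hA : ∀ (X : SchemeOver ℂ) (D : UnitaryBallQuotientDatum 5 X),
      algebraicClasses X 2 ≤
        (⨆ (W : Submodule D.E (Fin (5 + 1) → D.E))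
            (_ : IsTotallyPositive (conjRingHom D.E) D.H W) (_ : Module.finrank D.E W = 2),
            classesSupportedOn X (D.specialSubvariety W) (2 * 2)) ⊔
          Submodule.span ℂ {z : complexBetti X (2 * 2) | ∃ d₁ ∈ algebraicClasses X 1,
            ∃ d₂ ∈ algebraicClasses X 1,
              z = cupProduct (show 2 * 1 + 2 * 1 = 2 * 2 by norm_num) d₁ d₂}) :
    (∀ (X : SchemeOver ℂ) (D : UnitaryBallQuotientDatum 5 X) (c : complexBetti X (2 * 2)),
        IsRationalClass c → IsOfHodgeType 5 X (2 * 2) 2 2 c → c ∈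
          (⨆ (W : Submodule D.E (Fin (5 + 1) → D.E))
            (_ : IsTotallyPositive (conjRingHom D.E) D.H W) (_ : Module.finrank D.E W = 2),
            classesSupportedOn X (D.specialSubvariety W) (2 * 2)) ⊔
          Submodule.span ℂ {z : complexBetti X (2 * 2) | ∃ d₁ ∈ algebraicClasses X 1,
            ∃ d₂ ∈ algebraicClasses X 1,
              z = cupProduct (show 2 * 1 + 2 * 1 = 2 * 2 by norm_num) d₁ d₂}) ↔
      ∀ (X : SchemeOver ℂ) (D : UnitaryBallQuotientDatum 5 X) (c : complexBetti X (2 * 2)),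
        IsRationalClass c → IsOfHodgeType 5 X (2 * 2) 2 2 c → c ∈ algebraicClasses X 2 :=
  ⟨fun hS X D c hr hh ↦ span_le_algebraicClasses hcup D (hS X D c hr hh),
    fun h X D c hr hh ↦ hA X D (h X D c hr hh)⟩

end Summit.HodgeConjecture.HodgeConjecture.Theorems.HigherBlasiusRogawskiClass.Negative

end
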